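import Literature.Analysis.FluidPDE.MVIdentitiesAveraged
import Literature.Analysis.FluidPDE.ClassicalEulerTestFunctions
import Summits.AtomisticToContinuum.HydrodynamicLimit.Theorems.BoxDissipativeWeakStrongRelativeEnergyStabilityTimeZeroHelpers
import Summits.AtomisticToContinuum.HydrodynamicLimit.Theorems.BoxDissipativeWeakStrongRelativeEnergyStabilityCoerciveHelpers
import HarnessLib

/-!
# Crux `RelativeEnergyStability` (stmt-AtomisticToContinuum-17653), line `registered`, heart stub S-X — part 3:
# pointwise bookkeeping at one box state

For a box state `U = (ρ̂, m̂, Ê)` read in BF's phase space (`boxPhase U`) against the point datum `d = pdAt T ρ u θ (t,x)`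
of the strong solution, this file identifies the integrands of the route's closure statements and of the balance laws
with the pieces of the vendored BF engine (`momI`, `entI`, `contI`, `relEnergyZ`, `rawRHS`, `reducedRHS`):

* `sx_boxTemp_eq`: the box temperature `Th` of K1/K2 is the `stateTemp` of the cut law at `boxPhase U`;
* `sx_momI_box`, `sx_entI_box`, `sx_contI_box`, `sx_clampedRelEnergy_box`: the K1 / K2 / S-B integrands and the clamped
  box energy are `momI`, `entI`, `contI`, and `Ê − m̂·u + ρ̂φ₁ − θ ρ̂ Z(ŝ) + p_cut`;
* `sx_rawRHS_add_div`: `rawRHS + (p divU + U·∇p) = reducedRHS` at EVERY box state (BF Step 1, `rawRHS_add_div_eq`, plus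
  the vacuum case by direct computation).
-/

noncomputable section

namespace Summit.AtomisticToContinuum.HydrodynamicLimit.Theorems.RES

open MeasureTheory Filter Set Function
open scoped Topology InnerProductSpace
open Summit.AtomisticToContinuum.HydrodynamicLimit.Theses.BoxDissipativeWeakStrong
open Literature.MathematicalPhysics.KineticTheory Literature.Analysis.FluidPDE Literature.Analysis.FunctionSpaces
open Literature.Analysis.FluidPDE.CompressibleEuler
open Literature.Analysis.FluidPDE.CompressibleEuler.EulerPhase
open Literature.Analysis.FluidPDE.CompressibleEuler.StrongPointData

/-- The box temperature of K1/K2, `Th(ρ̂,m̂,Ê) = ⅔(Ê/ρ̂ − |m̂|²/(2ρ̂²))`, is the cut law's `stateTemp` at `boxPhase U`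
(internal energy `Ê − |m̂|²/(2ρ̂)`); both vanish on vacuum (`x/0 = 0`). -/
theorem sx_boxTemp_eq (σ η₁ : ℝ) (U : BoxState) :
    2 / 3 * (U.2.2 / U.1 - ‖U.2.1‖ ^ 2 / (2 * U.1 ^ 2)) =
      stateTemp (cutEOS σ η₁) (dens (boxPhase U)) (ien (boxPhase U)) := by
  simp only [stateTemp, boxPhase, dens_mk, ien_mk, tz_temperature_eq]
  by_cases h : U.1 = 0
  · simp [h]
  · field_simp

/-- `dens (boxPhase U) = ρ̂`, `mom (boxPhase U) = m̂`, `ien (boxPhase U) = Ê − ‖m̂‖²/(2ρ̂)`. -/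
theorem sx_boxPhase_proj (U : BoxState) :
    dens (boxPhase U) = U.1 ∧ mom (boxPhase U) = U.2.1 ∧ ien (boxPhase U) = U.2.2 - ‖U.2.1‖ ^ 2 / (2 * U.1) :=
  ⟨rfl, rfl, rfl⟩

section Box

variable {σ η₁ T : ℝ} {ρ θ : ℝ → T3 → ℝ} {u : ℝ → T3 → V3}

/-- **K1's integrand is `momI`.** At `d = pdAt T ρ u θ (t,x)`:
`m̂·∂ₜu + (m̂⊗m̂/ρ̂):∇u + p_cut(ρ̂,θ̂) div u = momI_cut(d, boxPhase U)`. -/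
theorem sx_momI_box (t : ℝ) (x : T3) (U : BoxState) :
    inner ℝ U.2.1 (Torus.timeDerivWithin (Ico 0 T) u t x) +
        (∑ i, ∑ j, U.2.1 i * U.2.1 j / U.1 * Torus.partialDeriv j (fun y => u t y i) x) +
        U.1 * (2 / 3 * (U.2.2 / U.1 - ‖U.2.1‖ ^ 2 / (2 * U.1 ^ 2))) * cutCompressibility η₁ (U.1 * σ ^ 3) *
          Torus.divergence (u t) x =
      (pdAt T ρ u θ (t, x)).momI (cutEOS σ η₁) (boxPhase U) := by
  rw [sx_boxTemp_eq σ η₁ U]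
  simp only [StrongPointData.momI, pdAt, classicalPointData, StrongPointData.divU, boxPhase, dens_mk, mom_mk, ien_mk,
    Torus.divergence, inner_eq_sum']
  have hp : ∀ r ϑ, (cutEOS σ η₁).p r ϑ = r * ϑ * cutCompressibility η₁ (r * σ ^ 3) := fun _ _ => rfl
  rw [hp]
  congr 1
  congr 1
  exact Finset.sum_congr rfl fun i _ => mul_comm _ _

/-- **K2's integrand is `entI`.** At `d = pdAt T ρ u θ (t,x)` and for the clamp `Z_{a,b}`:
`ρ̂ Z(ŝ) ∂ₜθ + Z(ŝ) m̂·∇θ = entI_cut(Z_{a,b}; d, boxPhase U)`. -/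
theorem sx_entI_box (a b t : ℝ) (x : T3) (U : BoxState) :
    U.1 * max a (min ((cutEOS σ η₁).s U.1 (2 / 3 * (U.2.2 / U.1 - ‖U.2.1‖ ^ 2 / (2 * U.1 ^ 2)))) b) *
          Torus.timeDerivWithin (Ico 0 T) θ t x +
        max a (min ((cutEOS σ η₁).s U.1 (2 / 3 * (U.2.2 / U.1 - ‖U.2.1‖ ^ 2 / (2 * U.1 ^ 2)))) b) *
          inner ℝ U.2.1 (Torus.gradient (θ t) x) =
      (pdAt T ρ u θ (t, x)).entI (cutEOS σ η₁) (clamp a b) (boxPhase U) := by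
  rw [sx_boxTemp_eq σ η₁ U]
  simp only [StrongPointData.entI, pdAt, classicalPointData, boxPhase, dens_mk, mom_mk, ien_mk, clamp, inner_eq_sum',
    Finset.mul_sum]
  congr 1
  refine Finset.sum_congr rfl fun i _ => ?_
  ring

/-- **The box continuity integrand is `contI`** once `φ = φ₁` has `∂ₜφ₁ = d.φ₁t`, `∇φ₁ = d.gφ₁` (supplied by
`sx_energyTest_derivs`). -/
theorem sx_contI_box {t : ℝ} {x : T3} {φ : ℝ → T3 → ℝ}
    (hφt : Torus.timeDerivWithin (Ico 0 T) φ t x = (pdAt T ρ u θ (t, x)).φ₁t (cutEOS σ η₁))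
    (hφg : ∀ j, Torus.gradient (φ t) x j = (pdAt T ρ u θ (t, x)).gφ₁ (cutEOS σ η₁) j) (U : BoxState) :
    U.1 * Torus.timeDerivWithin (Ico 0 T) φ t x + inner ℝ U.2.1 (Torus.gradient (φ t) x) =
      (pdAt T ρ u θ (t, x)).contI (cutEOS σ η₁) (boxPhase U) := by
  simp only [StrongPointData.contI, boxPhase, dens_mk, mom_mk, inner_eq_sum', hφt]
  congr 1
  exact Finset.sum_congr rfl fun j _ => by rw [hφg j, mul_comm]

/-- **The clamped box energy in BF's tested form**: `ℰ_Z(U | (ρ,u,θ)(t,x)) = Ê − m̂·u + ρ̂ φ₁ − θ ρ̂ Z_{a,b}(ŝ) + p_cut(ρ,θ)`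
with `φ₁ = ½|u|² − μ_cut(ρ,θ)` (`energyTestFunction`) and K2's entropy expression. -/
theorem sx_clampedRelEnergy_box (a b t : ℝ) (x : T3) (U : BoxState) :
    clampedRelEnergy σ η₁ a b (ρ t x) (u t x) (θ t x) U =
      U.2.2 - inner ℝ U.2.1 (u t x) + U.1 * energyTestFunction (cutEOS σ η₁) ρ u θ t x -
        θ t x * (U.1 * max a (min ((cutEOS σ η₁).s U.1 (2 / 3 * (U.2.2 / U.1 - ‖U.2.1‖ ^ 2 / (2 * U.1 ^ 2)))) b)) +
        (cutEOS σ η₁).p (ρ t x) (θ t x) := by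
  rw [tz_clampedRelEnergy_eq, sx_boxTemp_eq σ η₁ U]
  simp only [energyTestFunction, clamp, inner_eq_sum', boxPhase, dens_mk, ien_mk, stateTemp, tz_temperature_eq]
  have : ∑ i, U.2.1 i * u t x i = ∑ i, u t x i * U.2.1 i := Finset.sum_congr rfl fun i _ => mul_comm _ _
  rw [this]

/-- The clamped box energy is BF's `relEnergyZ` at the FULL point datum (which it reads only through `r, Θ, U`). -/
theorem sx_clampedRelEnergy_eq_pdAt (a b t : ℝ) (x : T3) (U : BoxState) :
    clampedRelEnergy σ η₁ a b (ρ t x) (u t x) (θ t x) U =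
      (pdAt T ρ u θ (t, x)).relEnergyZ (cutEOS σ η₁) (clamp a b) (boxPhase U) := by
  simp only [clampedRelEnergy, strongData, pdAt, classicalPointData, StrongPointData.relEnergyZ]

/-- **BF Step 1 at every box state**: `rawRHS + (p(r,Θ) divU + U·∇p(r,Θ)) = reducedRHS`, for the cut law, at a point
datum with `r ≠ 0` satisfying the momentum equation — on the quadrant and frozen states by `rawRHS_add_div_eq`, on vacuum
(`ρ̂ = 0`, where a box carries `m̂ = 0`, `Ê = 0`) by direct computation (`p_cut(0,·) = 0`). -/
theorem sx_rawRHS_add_div (Z : ℝ → ℝ) {d : StrongPointData} (hr : d.r ≠ 0) (hmom : d.MomentumEq (cutEOS σ η₁))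
    (U : BoxState) (hvac : U.1 = 0 → U.2.1 = 0 ∧ U.2.2 = 0) :
    rawRHS (cutEOS σ η₁) Z d (dens (boxPhase U)) (ien (boxPhase U)) (mom (boxPhase U)) +
        ((cutEOS σ η₁).p d.r d.Θ * d.divU + ∑ j, d.U j * d.gp (cutEOS σ η₁) j) =
      reducedRHS (cutEOS σ η₁) Z d (dens (boxPhase U)) (ien (boxPhase U)) (mom (boxPhase U)) := by
  by_cases h0 : U.1 = 0
  · obtain ⟨hm, hE⟩ := hvac h0
    have hp0 : ∀ ϑ, (cutEOS σ η₁).p 0 ϑ = 0 := fun ϑ => by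
      show 0 * ϑ * cutCompressibility η₁ (0 * σ ^ 3) = 0; ring
    simp only [boxPhase, dens_mk, ien_mk, mom_mk, h0, hm, hE, rawRHS, reducedRHS, hp0]
    simp
    field_simp
    ring
  · exact rawRHS_add_div_eq (cutEOS σ η₁) Z d h0 hr hmom _ _


/-- **The master inequality on a frozen state of small density** (one-particle boxes: `E_int = 0 < ρ̂ ≤ ρs`, where Lean's
`log 0 = 0` makes the cut entropy junk but CLAMPED): with the explicit constants of `cm_reducedRHS_le_lin` (data bounded by
`M` over a reference state with `r ≥ rmin`, `|p| ≤ Pk`, `|s|,|pρ|,|pϑ| ≤ Sk`, `|μ| ≤ μM`, `0 ≤ Θ ≤ ΘM`, `p ≥ pmin > 0`) and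
`ρs (μM + ΘM·max|a||b|) ≤ pmin/2`, one has `reducedRHS ≤ (2A₁ + 2(A₂ρs + A₃)/pmin) · ℰ_Z`. -/
theorem sx_reduced_le_frozen {σ η₁ a b M Pk Sk μM ΘM pmin rmin ρs : ℝ} {d : StrongPointData} (hM : 0 ≤ M)
    (hrmin : 0 < rmin) (hr : rmin ≤ d.r) (hB : d.Bounded M) (hab : a ≤ b)
    (hPk : |(cutEOS σ η₁).p d.r d.Θ| ≤ Pk) (hSk : |(cutEOS σ η₁).s d.r d.Θ| ≤ Sk)
    (hpρ : |d.pρ (cutEOS σ η₁)| ≤ Sk) (hpϑ : |d.pϑ (cutEOS σ η₁)| ≤ Sk)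
    (hμ : |(cutEOS σ η₁).chemPotential d.r d.Θ| ≤ μM) (hΘ0 : 0 ≤ d.Θ) (hΘ : d.Θ ≤ ΘM) (hpmin : 0 < pmin)
    (hp : pmin ≤ (cutEOS σ η₁).p d.r d.Θ) (hρs0 : 0 ≤ ρs) (hρs' : ρs * (μM + ΘM * max |a| |b|) ≤ pmin / 2)
    {w : EulerPhase} (hρ : 0 < dens w) (hE : ien w = 0) (hρs : dens w ≤ ρs) :
    reducedRHS (cutEOS σ η₁) (clamp a b) d (dens w) (ien w) (mom w) ≤
      (2 * (3 * M + (Sk + max |a| |b|) * M / 2) +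
          2 * ((2 * Sk * (M + 3 * M * M) / rmin + (Sk + max |a| |b|) * (M + 3 * M * M) +
                3 / 2 * (Sk + max |a| |b|) * M) * ρs + (3 * M * Pk + 2 * Sk * (M + 3 * M * M))) / pmin) *
        d.relEnergyZ (cutEOS σ η₁) (clamp a b) w := by
  have hSk0 : 0 ≤ Sk := (abs_nonneg _).trans hSk
  have hZb0 : 0 ≤ max |a| |b| := (abs_nonneg a).trans (le_max_left _ _)
  have hPk0 : 0 ≤ Pk := (abs_nonneg _).trans hPk
  have hMM : 0 ≤ M + 3 * M * M := by positivity
  -- the linear bound on `reducedRHS` (pressure of the frozen state vanishes)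
  have hPw : |(cutEOS σ η₁).p (dens w) (stateTemp (cutEOS σ η₁) (dens w) (ien w))| ≤ 0 := by
    rw [hE]
    have : (cutEOS σ η₁).p (dens w) (stateTemp (cutEOS σ η₁) (dens w) 0) = 0 := by
      show dens w * stateTemp (cutEOS σ η₁) (dens w) 0 * cutCompressibility η₁ (dens w * σ ^ 3) = 0
      simp [stateTemp, tz_temperature_eq]
    rw [this, abs_zero]
  have hlin := cm_reducedRHS_le_lin (eos := cutEOS σ η₁) (Z := clamp a b) (m := mom w) (E := ien w) hM hrmin hr hρ.le
    hB hPk hSk hpρ hpϑ (fun x => abs_clamp_le hab x) hPw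
  have hlow := co_frozen_lower (σ := σ) (η₁ := η₁) (a := a) (b := b) d.U hρ hE hab hμ hΘ0 hΘ hp hρs hρs'
  -- abbreviations for the constants
  set A₁ := 3 * M + (Sk + max |a| |b|) * M / 2 with hA₁
  set A₂ := 2 * Sk * (M + 3 * M * M) / rmin + (Sk + max |a| |b|) * (M + 3 * M * M) +
    3 / 2 * (Sk + max |a| |b|) * M with hA₂
  set A₃ := 3 * M * Pk + 2 * Sk * (M + 3 * M * M) with hA₃
  set Kin := dens w / 2 * ∑ i : Fin 3, (mom w i / dens w - d.U i) ^ 2 with hKin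
  have hA₁0 : 0 ≤ A₁ := by positivity
  have hA₂0 : 0 ≤ A₂ := by positivity
  have hA₃0 : 0 ≤ A₃ := by positivity
  have hKin0 : 0 ≤ Kin := co_kin_nonneg d.U hρ.le
  have h2Kin : dens w * ∑ i : Fin 3, (mom w i / dens w - d.U i) ^ 2 = 2 * Kin := by rw [hKin]; ring
  have hrelZ : (strongData d.r d.U d.Θ).relEnergyZ (cutEOS σ η₁) (clamp a b) w =
      d.relEnergyZ (cutEOS σ η₁) (clamp a b) w := rfl
  rw [hrelZ] at hlow
  set X := d.relEnergyZ (cutEOS σ η₁) (clamp a b) w with hX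
  have hlin' : reducedRHS (cutEOS σ η₁) (clamp a b) d (dens w) (ien w) (mom w) ≤ A₁ * (2 * Kin) + A₂ * ρs + A₃ := by
    rw [h2Kin] at hlin
    have hρs1 : A₂ * dens w ≤ A₂ * ρs := mul_le_mul_of_nonneg_left hρs hA₂0
    linarith
  -- combine
  have hkey : A₁ * (2 * Kin) + A₂ * ρs + A₃ ≤ (2 * A₁ + 2 * (A₂ * ρs + A₃) / pmin) * (Kin + pmin / 2) := by
    have h2 : A₂ * ρs + A₃ = 2 * (A₂ * ρs + A₃) / pmin * (pmin / 2) := by field_simp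
    have h3 : 2 * (A₂ * ρs + A₃) / pmin * (pmin / 2) ≤ 2 * (A₂ * ρs + A₃) / pmin * (Kin + pmin / 2) :=
      mul_le_mul_of_nonneg_left (by linarith) (by positivity)
    have h1 : A₁ * (2 * Kin) ≤ 2 * A₁ * (Kin + pmin / 2) := by nlinarith
    calc A₁ * (2 * Kin) + A₂ * ρs + A₃ = A₁ * (2 * Kin) + (A₂ * ρs + A₃) := by ring
      _ ≤ 2 * A₁ * (Kin + pmin / 2) + 2 * (A₂ * ρs + A₃) / pmin * (Kin + pmin / 2) := by linarith
      _ = (2 * A₁ + 2 * (A₂ * ρs + A₃) / pmin) * (Kin + pmin / 2) := by ring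
  have hC0 : 0 ≤ 2 * A₁ + 2 * (A₂ * ρs + A₃) / pmin := by positivity
  calc reducedRHS (cutEOS σ η₁) (clamp a b) d (dens w) (ien w) (mom w)
      ≤ A₁ * (2 * Kin) + A₂ * ρs + A₃ := hlin'
    _ ≤ (2 * A₁ + 2 * (A₂ * ρs + A₃) / pmin) * (Kin + pmin / 2) := hkey
    _ ≤ (2 * A₁ + 2 * (A₂ * ρs + A₃) / pmin) * X := mul_le_mul_of_nonneg_left hlow hC0

end Box

end Summit.AtomisticToContinuum.HydrodynamicLimit.Theorems.RES

end
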